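import Summits.BirchSwinnertonDyer.BirchSwinnertonDyer.Theorems.EisensteinPrimesXAcIsogenyInvariance
import Summits.BirchSwinnertonDyer.BirchSwinnertonDyer.Theorems.EisensteinPrimesBSDpOnCellCIsogenyNormalisation
import Summits.BirchSwinnertonDyer.BirchSwinnertonDyer.Theorems.EisensteinPrimesBSDpOnCellCResidualV11
import Literature.NumberTheory.EllipticCurves.IsogenyBaseChangeFieldProofs
import Literature.NumberTheory.EllipticCurves.ComplexMultiplicationLFunctionIsogenyHoldsProofs
import Literature.NumberTheory.EllipticCurves.CuspFormLFunctionLevelConductorProofs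
import Literature.NumberTheory.EllipticCurves.ModularCurveManinSemistableBridgeProofs
import HarnessLib

/-!
# Crux 4 `BSDpOnCellC` (stmt-BirchSwinnertonDyer-19034), line b1 v12 — the SPLIT conjunct of the wall `stub_imprimitiveCount` VERBATIM
# follows from its restriction to the curves at Keller–Yin's normalised lattice (every rational `p`-line ramified at `p`), stated with
# a LIGHT telescope, by TRANSPORT ALONG THE ISOGENY of [NORM] (cell `bsd-eis`, width seat `bsd-line-x2-p2` gen 11; skeleton UNCHANGED, W-79)

WHY. Conj. 2 of `stub_imprimitiveCount` asks, for EVERY split X2c datum, `m + Σ_{w∈Sf} λ(𝒫_w(f)) ≤ λ(X_ac^{Sf}(E_K[p^∞]))`. This seat's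
lineage proved it (modulo six PUB + [BR𝟙] + [BRω-split] + [AN-split]) only for the curves `W` whose rational `p`-lines are all RAMIFIED at
`p` (p679932, binder `hlat`), and gen 11 proved [NORM] (p681574): every split X2c curve is `ℚ`-isogenous to such a `W'`. The V11 chain
(`Reoriented.bsdpOnCellC_of_stubs_reoriented`) consumes the count at the Manin-OPTIMAL member of the class, which need not be `hlat`, so the
re-cut «conj. 2 ↦ conj. 2 + hlat» does NOT compose by name (finding of gen 11, p681931's bus line). THIS FILE closes the gap by moving the
count itself along the isogeny: both sides of the inequality are `ℚ`-isogeny invariants —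

* `curveLocalLambda_baseChange_eq_of_isIsogenous` — `λ(𝒫_w(f))` (`KellerYin2024.curveLocalLambda κ (W.baseChange K) w`, read off the
  local polynomial of `E_K` at `w` reduced mod `p`) is the same for `ℚ`-isogenous `W ∼ W'`: the isogeny base-changes to `K`
  (`Isogeny.exists_baseChange_field`) and `K`-isogenous elliptic curves have the same local polynomial at every finite place
  (`Isogeny.localPolynomialAt_eq_of_isElliptic`, Faltings / Knapp 11.67);
* `lambdaInvariant_xAc_baseChange_eq_of_isIsogenous` — `λ(X_ac^S(E_K[p^∞])) = λ(X_ac^S(E'_K[p^∞]))` (p683435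
  `XAcIsogenyInvariance.lambdaInvariant_xAc_eq_of_isIsogenous` at the base-changed isogeny; GV 2000 p. 28);

and the `W`-dependent binders of the telescope transport: `CellC` (`X2.cellC_iff_of_isIsogenous`), split multiplicative reduction
(`X2.IsogenyQuotientLine.hasSplitMultiplicativeReductionAtPrime_of_isIsogenous`), the newform (`IsNewformOf.of_isIsogenous`) and the conductor
(= the level of the newform, `IsNewformOf.level_eq_conductorNorm_of_exists_isNewformOf` — this uses modularity `exists_isNewformOf`, a
conjunct of `stub_publishedFacts`). The Heegner-datum binders (`Dt`, `H`, `ιK`, `P`, the Manin condition `¬ p ∣ Dt.c`, `hP`, `hPinf`, the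
twisted `L`-value) are simply DROPPED: the count does not see them. Hence

  `imprimitiveCount_split_of_hlatLight` — `exists_isNewformOf` + «the count at every split X2c pair WITH (hlat), light telescope»
  ⟹ conj. 2 of `stub_imprimitiveCount` VERBATIM (every split X2c pair, full telescope).

CONSEQUENCE FOR THE LINE. No re-cut of the registered composition is needed for the normalisation: a LEAD may keep `BSDpOnCellC_of` and prove
`stub_imprimitiveCount.2` as `imprimitiveCount_split_of_hlatLight hnf hlight` where `hlight` is the light hlat-count — p679932's argument
with the Heegner binders dropped — whose honest residual is [BR𝟙] + [BRω-split] + [AN-split] (then registrable as the lighter stubs).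

HONEST FRAMING: helper theorems only (0 defs, 0 named facts introduced, 0 sorry); §1 unconditional, §2 CONDITIONAL on modularity
`exists_isNewformOf` (PUB, in `stub_publishedFacts`) and on the inline light hlat-count; closes no stub by itself; no summit statement / BSD /
MC / IMC is proved for any curve; 0 cells / labels / tiers move.

References: [GreenbergVatsal2000] §2 p. 28; [KellerYin2024] §0.1 L262–263, §1.5, Lemma 5.1.2, Thm. 1.5.1 (arXiv:2402.12781v2); [Knapp1993]
Thm. 11.67; [Faltings1983Endlichkeit] §5 Kor. 2; [AtkinLehner1970] Thm. 4; [DiamondShurman2005] Thm. 8.8.1; [Castella2018] Def. 2.2; p681574,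
p681931, p683435 (this seat), p679932 (g10).
-/

set_option autoImplicit false
set_option linter.dupNamespace false -- the summit namespace `…BirchSwinnertonDyer.BirchSwinnertonDyer.Theorems` (Sub = Summit, D-0017) trips it

noncomputable section

open scoped Classical MatrixGroups ModularForm

open CongruenceSubgroup WeierstrassCurve NumberField IsDedekindDomain Field PowerSeries
  Literature.NumberTheory.EllipticCurves Literature.NumberTheory.EllipticCurves.GreenbergSelmer
  Literature.NumberTheory.EllipticCurves.ModularForms Literature.NumberTheory.QuadraticFields
  Literature.NumberTheory.EllipticCurves.Rank1Residual
  Literature.NumberTheory.EllipticCurves.Rank1Residual.Typed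
  Literature.NumberTheory.EllipticCurves.KrizLi2019
  Literature.NumberTheory.EllipticCurves.GreenbergVatsal2000
  Literature.NumberTheory.EllipticCurves.Wuthrich2014
  Literature.NumberTheory.EllipticCurves.SteinWuthrich2013
  Literature.NumberTheory.EllipticCurves.Castella2018Exceptional
  Literature.NumberTheory.GaloisRepresentations Literature.NumberTheory.GaloisCohomology
  Literature.NumberTheory.Automorphic
  Summit.BirchSwinnertonDyer.Rank1Residual.X11b.AcSelmer
  Summit.BirchSwinnertonDyer.Rank1Residual.X11b.Halves
  Summit.BirchSwinnertonDyer.Rank1Residual.X11b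
  Summit.BirchSwinnertonDyer.Rank1Residual Summit.BirchSwinnertonDyer.Rank1Residual.X1
  Summit.BirchSwinnertonDyer.Rank1Residual.X2
  Summit.BirchSwinnertonDyer.BirchSwinnertonDyer.Theorems
open Literature.NumberTheory.EllipticCurves.KellerYin2024 (curveLocalLambda)

namespace Summit.BirchSwinnertonDyer.BirchSwinnertonDyer.Theorems.ImprimitiveCountSplitTransport

/-! ## §1 The two sides of the count are `ℚ`-isogeny invariants -/

section Invariants

variable {W W' : WeierstrassCurve ℚ} [W.IsElliptic] [W'.IsElliptic] {p : ℕ} [hp : Fact p.Prime]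
  (K : Type) [Field K] [NumberField K]

omit [W.IsElliptic] [W'.IsElliptic] hp in
/-- A `ℚ`-isogeny base-changes to a `K`-isogeny of the base-changed curves (`Isogeny.exists_baseChange_field`): `E_K ∼ E'_K`.
[cite: SilvermanAEC2009, III.§4 (Definition, p. 66) with I.§3 Remark 3.1] -/
theorem isIsogenous_baseChange (h : IsIsogenous W W') : IsIsogenous (W.baseChange K) (W'.baseChange K) := by
  obtain ⟨φ⟩ := h
  obtain ⟨φK, -, -, -⟩ := Isogeny.exists_baseChange_field K φ
  exact ⟨φK⟩

/-- **`λ(𝒫_w(f))` is a `ℚ`-isogeny invariant**: `curveLocalLambda κ (W.baseChange K) w` is `[Γ : Γ_w] ·` (multiplicity of `(Nw)⁻¹` as a root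
of the local polynomial of `E_K` at `w` reduced mod `p`), and `K`-isogenous elliptic curves have the same local polynomial at every finite
place (`Isogeny.localPolynomialAt_eq_of_isElliptic`, Faltings 1983 §5 Kor. 2 / Knapp Thm. 11.67).
[cite: Knapp1993, Thm. 11.67 (PDF p. 281)] [cite: KellerYin2024, §1.5 (arXiv:2402.12781v2 TeX L1337–1341)] -/
theorem curveLocalLambda_baseChange_eq_of_isIsogenous (h : IsIsogenous W W') (κ : ZpExtension K p)
    (w : HeightOneSpectrum (𝓞 K)) :
    curveLocalLambda κ (W.baseChange K) w = curveLocalLambda κ (W'.baseChange K) w := by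
  haveI : (W.baseChange K).IsElliptic := by rw [baseChange]; infer_instance
  haveI : (W'.baseChange K).IsElliptic := by rw [baseChange]; infer_instance
  obtain ⟨φK⟩ := isIsogenous_baseChange K h
  have hloc : (W.baseChange K).localPolynomialAt w = (W'.baseChange K).localPolynomialAt w :=
    φK.localPolynomialAt_eq_of_isElliptic w
  rw [KellerYin2024.curveLocalLambda_eq, KellerYin2024.curveLocalLambda_eq, GreenbergVatsal2000.eulerFactorModP,
    GreenbergVatsal2000.eulerFactorModP, hloc]

/-- **`λ(X_ac^S(E_K[p^∞]))` is a `ℚ`-isogeny invariant** (p683435 `XAcIsogenyInvariance.lambdaInvariant_xAc_eq_of_isIsogenous` at the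
base-changed isogeny; the b1 telescope's `XAc` is `X11b.AcSelmer.XAc`, definitionally Castella's `Castella2018.AcSelmer.XAc`).
[cite: GreenbergVatsal2000, §2 p. 28 ("The λ-invariant is always unchanged by an isogeny")] [cite: Castella2018, Def. 2.2 (arXiv:1704.06608 p. 5)] -/
theorem lambdaInvariant_xAc_baseChange_eq_of_isIsogenous (h : IsIsogenous W W') (κ : ZpExtension K p)
    (𝔭 : HeightOneSpectrum (𝓞 K)) (S : Set (HeightOneSpectrum (𝓞 K))) (γ : absoluteGaloisGroup K) [Fact (κ.IsTopGenerator γ)] :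
    lambdaInvariant p (XAc (W.baseChange K) p κ 𝔭 S γ) = lambdaInvariant p (XAc (W'.baseChange K) p κ 𝔭 S γ) := by
  haveI : (W.baseChange K).IsElliptic := by rw [baseChange]; infer_instance
  haveI : (W'.baseChange K).IsElliptic := by rw [baseChange]; infer_instance
  exact XAcIsogenyInvariance.lambdaInvariant_xAc_eq_of_isIsogenous κ 𝔭 S γ (isIsogenous_baseChange K h)

end Invariants

/-! ## §2 Conj. 2 of the wall from its light restriction to the normalised curves -/

/-- **Conj. 2 of `stub_imprimitiveCount` (b1 v12) VERBATIM from the light hlat-count.** Hypotheses: modularity `exists_isNewformOf` (PUB) and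
`hlight`: for every split X2c pair `(W, p)` WHOSE RATIONAL `p`-LINES ARE ALL RAMIFIED AT `p`, and every light datum (no modular
parametrisation / Heegner point / Manin binder), the count `m + Σ_{w∈Sf} λ(𝒫_w(f)) ≤ λ(X_ac^{Sf}(E_K[p^∞]))`. Conclusion: the second conjunct
of the registered `stub_imprimitiveCount` (every split X2c pair, full telescope). Proof: normalise `W ∼ W'` by [NORM]
(`IsogenyNormalisation.exists_isIsogenous_forall_not_lineUnramifiedAt`), move `CellC` / split / newform / conductor to `W'`, apply `hlight`
at `W'` with the same `(N, K, κ, γ, 𝔭, 𝔭̄, f, ι', Ω, Q, Sf, m)`, and move both sides of the inequality back to `W` (§1).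
[cite: KellerYin2024, §0.1 L262–263, Lemma 5.1.2 and Thm. 1.5.1 (arXiv:2402.12781v2) (shape only; nothing asserted)]
[cite: GreenbergVatsal2000, §2 p. 28] [cite: Knapp1993, Thm. 11.67] [cite: AtkinLehner1970, Thm. 4] -/
theorem imprimitiveCount_split_of_hlatLight (hnf : exists_isNewformOf)
    (hlight : ∀ (W : WeierstrassCurve ℚ) [W.IsElliptic] [W.IsGloballyMinimal] (p : ℕ) [Fact p.Prime],
      ∀ (N : ℕ) [NeZero N] (K : Type) [Field K] [NumberField K],
        CellC W p → W.HasSplitMultiplicativeReductionAtPrime p →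
        (∀ Φ : AddSubgroup (geomTorsion W (p : ℤ)), IsRationalLine W p Φ → ¬ LineUnramifiedAt W p Φ) →
        W.conductorNorm ℤ = N → IsImaginaryQuadratic K → NumberField.discr K < -4 → SatisfiesHeegnerHypothesis N K →
        Odd (NumberField.discr K) →
        ∀ (κ : ZpExtension K p), κ.IsAnticyclotomic →
          ∀ (γ : Field.absoluteGaloisGroup K) [Fact (κ.IsTopGenerator γ)]
            (𝔭 : HeightOneSpectrum (𝓞 K)), ((p : ℕ) : 𝓞 K) ∈ 𝔭.asIdeal →
            𝔭.asIdeal.ramificationIdx (𝓞 ℚ) = 1 → 𝔭.asIdeal.inertiaDeg (𝓞 ℚ) = 1 →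
            ∀ (𝔭bar : HeightOneSpectrum (𝓞 K)), ((p : ℕ) : 𝓞 K) ∈ 𝔭bar.asIdeal → 𝔭bar ≠ 𝔭 →
              ((Ideal.span {(p : ℤ)}).primesOver (𝓞 K)).ncard = 2 →
            ∀ (f : CuspForm (CongruenceSubgroup.Gamma0 N) 2), IsNewformOf W f →
              ∀ (ι' : PadicAlgCl p ≃+* ℂ),
                (∀ (w : InfinitePlace K) (k : 𝓞 K),
                  k ∈ 𝔭.asIdeal ↔ ‖ι'.symm (w.embedding (k : K))‖ < 1) →
                ∀ (ΩK : ℂ) (Ωp : ℂ_[p]) (Q : PowerSeries 𝓞_ℂ_[p]), ΩK ≠ 0 → ‖Ωp‖ = 1 →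
                  R1.IsBDPLFunctionInt p ι' 𝔭 κ γ f ΩK Ωp Q →
                    ∀ (Sf : Finset (HeightOneSpectrum (𝓞 K))),
                    (∀ w : HeightOneSpectrum (𝓞 K), w ∈ Sf ↔
                      (((W.conductorNorm ℤ : ℤ) : 𝓞 K) ∈ w.asIdeal ∧ ((p : ℕ) : 𝓞 K) ∉ w.asIdeal)) →
                    ∀ m : ℕ, ‖((PowerSeries.coeff m Q : 𝓞_ℂ_[p]) : ℂ_[p])‖ = 1 →
                      (∀ i < m, ‖((PowerSeries.coeff i Q : 𝓞_ℂ_[p]) : ℂ_[p])‖ < 1) →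
                        m + ∑ w ∈ Sf, curveLocalLambda κ (W.baseChange K) w ≤
                          lambdaInvariant p (XAc (W.baseChange K) p κ 𝔭bar (↑Sf : Set (HeightOneSpectrum (𝓞 K))) γ)) :
    ∀ (W : WeierstrassCurve ℚ) [W.IsElliptic] [W.IsGloballyMinimal] (p : ℕ) [Fact p.Prime],
      ∀ (N : ℕ) [NeZero N] (K : Type) [Field K] [NumberField K] (Dt : ModularParametrizationData W N)
        (H : HeegnerDatum N (NumberField.discr K)) (ιK : K →+* ℂ) (P : (W.baseChange K).toAffine.Point),
        CellC W p → W.HasSplitMultiplicativeReductionAtPrime p → W.conductorNorm ℤ = N →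
        IsImaginaryQuadratic K → NumberField.discr K < -4 → SatisfiesHeegnerHypothesis N K →
        (W.quadraticTwist (NumberField.discr K : ℚ)).entireLFunction 1 ≠ 0 →
        WeierstrassCurve.Affine.Point.map ιK.toRatAlgHom P = heegnerPointComplex Dt H →
        ¬ (p : ℤ) ∣ Dt.c → ¬ IsOfFinAddOrder P →
        Odd (NumberField.discr K) →
        ∀ (κ : ZpExtension K p), κ.IsAnticyclotomic →
          ∀ (γ : Field.absoluteGaloisGroup K) [Fact (κ.IsTopGenerator γ)]
            (𝔭 : HeightOneSpectrum (𝓞 K)), ((p : ℕ) : 𝓞 K) ∈ 𝔭.asIdeal →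
            𝔭.asIdeal.ramificationIdx (𝓞 ℚ) = 1 → 𝔭.asIdeal.inertiaDeg (𝓞 ℚ) = 1 →
            ∀ (𝔭bar : HeightOneSpectrum (𝓞 K)), ((p : ℕ) : 𝓞 K) ∈ 𝔭bar.asIdeal → 𝔭bar ≠ 𝔭 →
              ((Ideal.span {(p : ℤ)}).primesOver (𝓞 K)).ncard = 2 →
            ∀ (f : CuspForm (CongruenceSubgroup.Gamma0 N) 2), IsNewformOf W f →
              ∀ (ι' : PadicAlgCl p ≃+* ℂ),
                (∀ (w : InfinitePlace K) (k : 𝓞 K),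
                  k ∈ 𝔭.asIdeal ↔ ‖ι'.symm (w.embedding (k : K))‖ < 1) →
                ∀ (ΩK : ℂ) (Ωp : ℂ_[p]) (Q : PowerSeries 𝓞_ℂ_[p]), ΩK ≠ 0 → ‖Ωp‖ = 1 →
                  R1.IsBDPLFunctionInt p ι' 𝔭 κ γ f ΩK Ωp Q →
                    ∀ (Sf : Finset (HeightOneSpectrum (𝓞 K))),
                    (∀ w : HeightOneSpectrum (𝓞 K), w ∈ Sf ↔
                      (((W.conductorNorm ℤ : ℤ) : 𝓞 K) ∈ w.asIdeal ∧ ((p : ℕ) : 𝓞 K) ∉ w.asIdeal)) →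
                    ∀ m : ℕ, ‖((PowerSeries.coeff m Q : 𝓞_ℂ_[p]) : ℂ_[p])‖ = 1 →
                      (∀ i < m, ‖((PowerSeries.coeff i Q : 𝓞_ℂ_[p]) : ℂ_[p])‖ < 1) →
                        m + ∑ w ∈ Sf, curveLocalLambda κ (W.baseChange K) w ≤
                          lambdaInvariant p (XAc (W.baseChange K) p κ 𝔭bar (↑Sf : Set (HeightOneSpectrum (𝓞 K))) γ) := by
  intro W _ _ p _ N _ K _ _ Dt H ιK P hc hsplit hN hK hd4 hHN _ _ _ _ hodd κ hκ γ _ 𝔭 h𝔭 he hf 𝔭bar h𝔭bar hne hsplit2 f hfW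
    ι' hι' ΩK Ωp Q hΩK hΩp hQ Sf hSf m hm hlt
  -- normalise along [NORM]
  have hp2 : p ≠ 2 := hc.2.1
  have hmult : W.HasMultiplicativeReductionAtPrime p := hc.2.2.2
  obtain ⟨W', hE', hmin', hiso, hlat', -⟩ :=
    IsogenyNormalisation.exists_isIsogenous_forall_not_lineUnramifiedAt W p hp2 hmult
  haveI := hE'
  haveI := hmin'
  -- transport the `W`-dependent binders
  have hc' : CellC W' p := (cellC_iff_of_isIsogenous (p := p) hiso).mp hc
  have hsplit' : W'.HasSplitMultiplicativeReductionAtPrime p :=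
    IsogenyQuotientLine.hasSplitMultiplicativeReductionAtPrime_of_isIsogenous hiso hsplit
  have hfW' : IsNewformOf W' f := hfW.of_isIsogenous hiso.symm_of_charZero
  have hN' : W'.conductorNorm ℤ = N := (IsNewformOf.level_eq_conductorNorm_of_exists_isNewformOf hnf hfW').symm
  have hSf' : ∀ w : HeightOneSpectrum (𝓞 K), w ∈ Sf ↔
      (((W'.conductorNorm ℤ : ℤ) : 𝓞 K) ∈ w.asIdeal ∧ ((p : ℕ) : 𝓞 K) ∉ w.asIdeal) := by
    rw [hN', ← hN]
    exact hSf
  -- the count at `W'`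
  have hcount := hlight W' p N K hc' hsplit' hlat' hN' hK hd4 hHN hodd κ hκ γ 𝔭 h𝔭 he hf 𝔭bar h𝔭bar hne hsplit2 f hfW' ι' hι'
    ΩK Ωp Q hΩK hΩp hQ Sf hSf' m hm hlt
  -- move both sides back to `W`
  have hsum : ∑ w ∈ Sf, curveLocalLambda κ (W.baseChange K) w = ∑ w ∈ Sf, curveLocalLambda κ (W'.baseChange K) w :=
    Finset.sum_congr rfl fun w _ ↦ curveLocalLambda_baseChange_eq_of_isIsogenous K hiso κ w
  have hlam : lambdaInvariant p (XAc (W.baseChange K) p κ 𝔭bar (↑Sf : Set (HeightOneSpectrum (𝓞 K))) γ) =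
      lambdaInvariant p (XAc (W'.baseChange K) p κ 𝔭bar (↑Sf : Set (HeightOneSpectrum (𝓞 K))) γ) :=
    lambdaInvariant_xAc_baseChange_eq_of_isIsogenous K hiso κ 𝔭bar _ γ
  rw [hsum, hlam]
  exact hcount

end Summit.BirchSwinnertonDyer.BirchSwinnertonDyer.Theorems.ImprimitiveCountSplitTransport

end
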